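import Summits.BirchSwinnertonDyer.BirchSwinnertonDyer.Theorems.ByReductionTypeAtTwoSupersingularFlatBlindCardPositionCore
import Summits.BirchSwinnertonDyer.BirchSwinnertonDyer.Theorems.ByReductionTypeAtTwoSupersingularFlatBlindKummerLineAtP
import Summits.BirchSwinnertonDyer.BirchSwinnertonDyer.Theorems.ByReductionTypeAtTwoSupersingularFlatBlindGlobalKummerGenerator
import Summits.BirchSwinnertonDyer.BirchSwinnertonDyer.Theorems.ByReductionTypeAtTwoSupersingularFlatBlindLevelPassage
import Summits.BirchSwinnertonDyer.BirchSwinnertonDyer.Theorems.ByReductionTypeAtTwoSupersingularFlatBlindTwistSideStrictCount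
import Summits.BirchSwinnertonDyer.BirchSwinnertonDyer.Theorems.ByReductionTypeAtTwoSupersingularFlatBlindCardTransport
import Summits.BirchSwinnertonDyer.Rank1Residual.X11b.KummerRelaxedStructures
import Literature.NumberTheory.GaloisRepresentations.SelmerStructureOnePlaceComparisonProofs
import Literature.NumberTheory.GaloisRepresentations.LocalGlobalCohomologyDualityProofs
import Literature.NumberTheory.EllipticCurves.BSDSelmerParityDokchitserBaseChangeProofs
import Literature.NumberTheory.EllipticCurves.BSDRootNumberSmallConductorProofs
import Mathlib.GroupTheory.PGroup
import HarnessLib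

/-!
# Route `ByReductionTypeAtTwo` (rung K4), crux `SupersingularRankZeroAtTwo` (item stmt-BirchSwinnertonDyer-19097), line
# `odd_blind_package` (registry v2.10.1), slot 5 `stub_CD` = CDC_H `OddBlindPackage.FlatBlindControlCardHondaAtTwo`:
# **(P2) THE POSITION ALGEBRA — the generic binder (hglob) of the position glue (★★ p816472) FROM the relaxed-vs-strict
# Poitou–Tate count (P1)** (cell `bsd-2adic`, LEAD ss-1 GEN 22; hand of LEAD GEN 21, memo `HOME/ss/gen21/HAND-TARGETS-CDC-4.md` 4c/4d)

HONEST FRAMING: THEOREMS ONLY (no definition, no named fact, no `sorry`, no instance); a helper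
(`--supports stmt-BirchSwinnertonDyer-19097`). `HTC7globAlg_natCard_selmerGroup_of_complement_of_relaxedCount` has the TYPE of the
LEAD GEN 21 scratch `HANDTARGETS_CDC4_GEN21.lean` :77–102 VERBATIM: (hglob) of `position_of_complement_of_lineCount` with the count
(P1) «`#H¹_𝓡 = p^J · #H¹_𝓢` for `J ≥ 1`» inserted as a hypothesis — and (P1) is the tree theorem ★★ p819324
`HTC7globPT_natCard_kummerRelaxed_eq (hPT)` (t42 GEN 42), so after this file (hglob) holds MODULO the print binder `hPT`
(Poitou–Tate duality for finite Selmer structures over `ℚ` with the real places, Milne ADT I 4.10), and with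
`flatBlindControlCardHondaAtTwo_of_glob` (LEAD GEN 22) **CDC_H ⇐ hPT**. The mathematics is Greenberg's position argument
(LNM 1716 §4, pp. 122–124) in kernel form: for a complement `L` of the Kummer line `Kum_J(E)_v` in `H¹(ℚ_v, E[p^J])`,
`H¹_𝓛 = ker(Ψ : H¹_𝓡 → H¹(ℚ_v, E[p^J])/L ≅ Kum_J(E)_v ≅ ℤ/p^J)` (Selmer structures agreeing off `v`: Howard 2004 §1.5 bookkeeping,
tree `SelmerStructureOnePlaceComparisonProofs`); `H¹_𝓡 ⊇ ℤ·κ(P₁) ≅ ℤ/p^J` with index `p^s = #H¹_𝓢 = #S⁰` (HT-C4(a) ★★ p814204 +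
stabilisation; `#S⁰ = #Ш[p^∞]·p^e`, HT-C2 ★★ p812748); `Ψ κ(P₁) = κ_v(P₁ ⊗ ℚ_v) = m • κ_v(Q₁)`, `m ≡ λ(P₁ ⊗ ℚ_p) (mod p^J)`
(the Kummer line at `p`, ★ p816936; the two models `ℚ_v`/`ℚ_[p]`), `m = p^e m₁ + p^J k` with `p ∤ m₁`; the abstract position core
(★ p816628) then counts `#ker Ψ = p^s · p^e` as soon as `e + s ≤ J` (`J₂ := J₀ + 2 #S⁰ + 1`). §1 the `p`-adic unit bookkeeping, §2 the
core with the unit `m₁`, §2b the order of `κ(P₁)` inside any subgroup (generic number field, classical `DecidableEq`, bridged over `ℚ`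
by `convert`), §3 the hand. Nothing booked; 19097 stays OPEN; BSD is proved for no curve by any of this. bears_on: K4 (19097).

References: [GreenbergLNM1716] §4 pp. 122–124; [Howard2004HeegnerKolyvagin] §1.5; [MilneADT2006] I Lemma 3.3, I §6;
[SilvermanAEC2009] VII.6.3, VIII.§2, X.§4 (**).
-/

set_option autoImplicit false
set_option linter.dupNamespace false

noncomputable section

open scoped Classical NumberField AddSubgroup

namespace Summit.BirchSwinnertonDyer.BirchSwinnertonDyer.Theorems

namespace OddBlindLocal

open NumberField IsDedekindDomain Field WeierstrassCurve Literature.NumberTheory.EllipticCurves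
  Literature.NumberTheory.GaloisRepresentations
open Literature.NumberTheory.GaloisRepresentations.DiscreteGaloisModule (SelmerStructure)
open Summit.BirchSwinnertonDyer.Rank1Residual.X11b

/-! ## §1 Arithmetic: the unit part of an integer congruent to `x ≠ 0` modulo `p^J`, `v(x) < J` -/

/-- If `m ∈ ℤ` is congruent modulo `p^J` to a nonzero `p`-adic integer `x` of valuation `e < J`, then
`m = p^e · m₁ + p^J · k` with `m₁ ∈ ℕ` prime to `p`. [folklore] -/
theorem exists_coprime_eq_pow_valuation_mul_add {p : ℕ} [hp : Fact p.Prime] {x : ℤ_[p]} (hx : x ≠ 0) {J : ℕ}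
    (heJ : x.valuation < J) {m : ℤ} (hm : (p : ℤ_[p]) ^ J ∣ x - m) :
    ∃ (m₁ : ℕ) (k : ℤ), p.Coprime m₁ ∧ m = (p : ℤ) ^ x.valuation * m₁ + (p : ℤ) ^ J * k := by
  set e := x.valuation with he
  set w : ℤ_[p] := (PadicInt.unitCoeff hx : ℤ_[p]) with hw
  have hxw : x = w * (p : ℤ_[p]) ^ e := PadicInt.unitCoeff_spec hx
  set m₁ : ℕ := PadicInt.appr w (J - e) with hm₁
  have hJe : e + (J - e) = J := Nat.add_sub_cancel' heJ.le
  -- `w - m₁ = p^(J-e) c`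
  obtain ⟨c, hc⟩ := Ideal.mem_span_singleton.mp (PadicInt.appr_spec (J - e) w)
  -- `m₁` is prime to `p`
  have hcop : p.Coprime m₁ := by
    rw [← PadicInt.norm_natCast_eq_one_iff]
    have hle : ‖(m₁ : ℤ_[p])‖ ≤ 1 := PadicInt.norm_le_one _
    by_contra hne
    have hlt : ‖(m₁ : ℤ_[p])‖ < 1 := lt_of_le_of_ne hle hne
    have hd : ‖w - (m₁ : ℤ_[p])‖ < 1 := by
      have h1 : ‖w - (m₁ : ℤ_[p])‖ ≤ (p : ℝ) ^ (-(J - e : ℕ) : ℤ) :=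
        (PadicInt.norm_le_pow_iff_mem_span_pow _ _).mpr (PadicInt.appr_spec (J - e) w)
      refine lt_of_le_of_lt h1 ?_
      have hp1 : (1 : ℝ) < p := by exact_mod_cast hp.out.one_lt
      have hJe' : 0 < J - e := Nat.sub_pos_of_lt heJ
      exact zpow_lt_one_of_neg₀ hp1 (by omega)
    have hw1 : ‖w‖ = 1 := PadicInt.norm_units _
    have : ‖w‖ < 1 := by
      have h := PadicInt.nonarchimedean (w - (m₁ : ℤ_[p])) (m₁ : ℤ_[p])
      rw [sub_add_cancel] at h
      exact lt_of_le_of_lt h (max_lt hd hlt)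
    exact absurd hw1 this.ne
  -- `(m - p^e m₁ : ℤ_[p]) ∈ p^J ℤ_[p]`
  have hdiff : (p : ℤ_[p]) ^ J ∣ ((m - (p : ℤ) ^ e * m₁ : ℤ) : ℤ_[p]) := by
    have h1 : ((m - (p : ℤ) ^ e * m₁ : ℤ) : ℤ_[p]) = -(x - m) + (p : ℤ_[p]) ^ e * (w - (m₁ : ℤ_[p])) := by
      push_cast
      rw [hxw]
      ring
    rw [h1]
    refine dvd_add (dvd_neg.mpr hm) ?_
    rw [hc, ← mul_assoc, ← pow_add, hJe]
    exact dvd_mul_right _ _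
  have hdvd : ((p : ℤ) ^ J) ∣ (m - (p : ℤ) ^ e * m₁) := by
    have h := (PadicInt.norm_le_pow_iff_mem_span_pow _ J).mpr (Ideal.mem_span_singleton.mpr hdiff)
    exact_mod_cast (PadicInt.norm_int_le_pow_iff_dvd.mp h)
  obtain ⟨k, hk⟩ := hdvd
  exact ⟨m₁, k, hcop, by linear_combination hk⟩

/-! ## §2 The abstract position core, with the unit adjustment -/

/-- `natCard_ker_eq_of_cyclic_position` with `Ψ δ = (p^e · m₁) • u` for `m₁` prime to `p` (replace the generator `u` by `m₁ • u`). [folklore] -/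
theorem natCard_ker_eq_of_cyclic_position_coprime {R C : Type*} [AddCommGroup R] [AddCommGroup C] {p J s e : ℕ}
    (hp : p.Prime) (hJ : e + s ≤ J) (hR : ∀ x : R, p ^ J • x = 0) (hRcard : Nat.card R = p ^ J * p ^ s)
    (δ : R) (hδ : addOrderOf δ = p ^ J) (u : C) (hu : addOrderOf u = p ^ J) (hC : ∀ c : C, c ∈ AddSubgroup.zmultiples u)
    (Ψ : R →+ C) {m₁ : ℕ} (hm₁ : p.Coprime m₁) (hΨδ : Ψ δ = (p ^ e * m₁) • u) :
    Nat.card Ψ.ker = p ^ s * p ^ e := by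
  have hcop : (addOrderOf u).Coprime m₁ := by rw [hu]; exact Nat.Coprime.pow_left _ hm₁
  have hu' : addOrderOf (m₁ • u) = p ^ J := by rw [hcop.addOrderOf_nsmul, hu]
  have hC' : ∀ c : C, c ∈ AddSubgroup.zmultiples (m₁ • u) := by
    obtain ⟨a, ha⟩ := exists_nsmul_eq_self_of_coprime (x := u) (n := m₁) (by rw [hu]; exact (Nat.Coprime.pow_left _ hm₁).symm)
    intro c
    obtain ⟨b, rfl⟩ := AddSubgroup.mem_zmultiples_iff.mp (hC c)
    refine AddSubgroup.mem_zmultiples_iff.mpr ⟨b * (a : ℤ), ?_⟩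
    rw [mul_zsmul, natCast_zsmul, ha]
  refine natCard_ker_eq_of_cyclic_position hp hJ hR hRcard δ hδ (m₁ • u) hu' hC' Ψ ?_
  rw [hΨδ, mul_comm, mul_nsmul]

/-! ## §2b The order of the Kummer class of a generator inside any subgroup of `H¹(K, E[p^J])` containing it -/

/-- For `E/K` of rank one with generator `P₁` modulo torsion, the Kummer class `κ(P₁)`, as an element of ANY subgroup
`S ≤ H¹(K, E[p^J])` containing it, has order exactly `p^J` (★ p817079 `kummerMapTorsion_zsmul_generator_eq_zero_iff`, read through
the subgroup's own `ℕ`-action; generic number field, classical `DecidableEq`). [cite: SilvermanAEC2009, VIII.§2] -/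
theorem addOrderOf_mk_kummerMapTorsion_generator {K : Type} [Field K] [NumberField K] (E : WeierstrassCurve K) [E.IsElliptic]
    {p : ℕ} [Fact p.Prime] (hr : E.mordellWeilRank = 1) (P₁ : E.toAffine.Point)
    (hgen : ∀ P : E.toAffine.Point, ∃ (a : ℤ) (t : E.toAffine.Point), IsOfFinAddOrder t ∧ P = a • P₁ + t)
    (J : ℕ) (hdiv : ∀ P : geomPoints E, ∃ Q : geomPoints E, ((p ^ J : ℕ) : ℤ) • Q = P)
    (S : AddSubgroup (galoisCohomology (E.torsionGaloisModule ((p ^ J : ℕ) : ℤ)) 1))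
    (hS : kummerMapTorsion E ((p ^ J : ℕ) : ℤ) hdiv P₁ ∈ S) :
    addOrderOf (⟨kummerMapTorsion E ((p ^ J : ℕ) : ℤ) hdiv P₁, hS⟩ : ↥S) = p ^ J := by
  refine Nat.dvd_antisymm (addOrderOf_dvd_of_nsmul_eq_zero ?_) ?_
  · apply Subtype.ext
    rw [AddSubmonoidClass.coe_nsmul, ZeroMemClass.coe_zero]
    exact galoisCohomology.nsmul_eq_zero_of_forall (E.torsionGaloisModule ((p ^ J : ℕ) : ℤ))
      (fun T : geomTorsion E ((p ^ J : ℕ) : ℤ) ↦ AddSubgroup.torsionBy.nsmul T) _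
  · have h1 : S.subtype (addOrderOf (⟨kummerMapTorsion E ((p ^ J : ℕ) : ℤ) hdiv P₁, hS⟩ : ↥S) •
        (⟨kummerMapTorsion E ((p ^ J : ℕ) : ℤ) hdiv P₁, hS⟩ : ↥S)) = 0 := by
      rw [addOrderOf_nsmul_eq_zero, map_zero]
    rw [map_nsmul, AddSubgroup.coe_subtype] at h1
    have h2 : kummerMapTorsion E ((p ^ J : ℕ) : ℤ) hdiv
        ((addOrderOf (⟨kummerMapTorsion E ((p ^ J : ℕ) : ℤ) hdiv P₁, hS⟩ : ↥S) : ℤ) • P₁) = 0 := by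
      rw [natCast_zsmul, map_nsmul]
      exact h1
    exact_mod_cast (kummerMapTorsion_zsmul_generator_eq_zero_iff E hr P₁ hgen J hdiv _).mp h2

/-! ## §3 (P2) THE POSITION ALGEBRA: (hglob) from the relaxed-vs-strict count (P1) -/

/-- ★★ **(P2) = HT-C7globAlg — THE POSITION ALGEBRA (hand of LEAD ss-1 GEN 21, memo `HAND-TARGETS-CDC-4.md` 4c, signature
VERBATIM = scratch `HANDTARGETS_CDC4_GEN21.lean` :77–102).** For `E/ℚ`, a prime `p`, the place `v ∋ p`, no `p`-torsion in `E(ℚ_v)`,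
`E(ℚ_p)`, `E(ℚ)`, `rank E(ℚ) = 1`, `Ш[p^∞]` finite, and the RELAXED-VS-STRICT COUNT (P1) `#H¹_𝓡 = p^J · #H¹_𝓢` at every level
`J ≥ 1` (`𝓡`/`𝓢` = Kummer everywhere, `⊤`/`⊥` at `v`): for `J ≫ 0`, every COMPLEMENT `L` of the Kummer line `Kum_J(E)_v` in
`H¹(ℚ_v, E[p^J])` and every Selmer structure `𝓛` = (Kummer off `v`, `L` at `v`) has `#H¹_𝓛 = #S⁰ · p^{v_p λ(P₁)}`, `S⁰` the
`p`-strict `p^∞`-Selmer group, `λ : E(ℚ_p) ↠ ℤ_p` normalised, `P₁` a generator modulo torsion. PROOF (Greenberg's position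
argument, kernel form): `H¹_𝓛 = ker (Ψ : H¹_𝓡 → H¹(ℚ_v, E[p^J]) / L)` (structures agreeing off `v`, Howard §1.5 bookkeeping);
`H¹(ℚ_v, E[p^J]) / L ≅ Kum_J(E)_v` is cyclic of order `p^J` on `u = κ_v(Q₁) mod L` (`L ⊓ Kum = ⊥`, `L ⊔ Kum = ⊤`, the Kummer line
★ p816936); `δ = κ(P₁) ∈ H¹_𝓡` has order `p^J` (★ p817079) and `Ψ δ = m • u`, `m ≡ λ(P₁ ⊗ ℚ_p) (mod p^J)`, so `m = p^e m₁ + p^J k`,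
`p ∤ m₁`, `e = v_p λ(P₁ ⊗ ℚ_p)`; `#H¹_𝓡 = p^J · #H¹_𝓢` (P1) `= p^J · #S⁰[p^J]` (HT-C4(a) ★★ p814204) `= p^J · #S⁰ = p^J · p^s`
for `J ≥ J₀` (stabilisation; `#S⁰ = #Ш[p^∞] · p^e = p^s`, HT-C2 ★★ p812748, so `e ≤ s`); the abstract position core (★ p816628,
with the unit `m₁`) gives `#ker Ψ = p^s · p^e` once `e + s ≤ J` — whence `J₂ := J₀ + 2 #S⁰ + 1`. Nothing booked; 19097 stays OPEN;
BSD is proved for no curve. [cite: GreenbergLNM1716, §4 pp. 122–124] [cite: Howard2004HeegnerKolyvagin, §1.5 (arXiv:1202.6340 §2.5)]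
[cite: SilvermanAEC2009, VIII.§2, X.§4 diagram (**)] -/
theorem HTC7globAlg_natCard_selmerGroup_of_complement_of_relaxedCount :
    ∀ (E : WeierstrassCurve ℚ) [E.IsElliptic] (p : ℕ) [Fact p.Prime]
      (v : HeightOneSpectrum (𝓞 ℚ)), ((p : ℕ) : 𝓞 ℚ) ∈ v.asIdeal →
      (∀ P : (E.baseChange (v.adicCompletion ℚ)).toAffine.Point, p • P = 0 → P = 0) →
      (∀ P : (E.baseChange ℚ_[p]).toAffine.Point, p • P = 0 → P = 0) →
      (∀ P : E.toAffine.Point, p • P = 0 → P = 0) →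
      E.mordellWeilRank = 1 → Finite (AddCommGroup.primaryComponent E.sha p) →
      (∀ J : ℕ, 1 ≤ J →
        Nat.card (SelmerStructure.selmerGroup (ρ := E.torsionGaloisModule ((p ^ J : ℕ) : ℤ))
            (KummerPT.kummerRelaxed E (p ^ J) {(Sum.inr v : Place ℚ)})) =
          p ^ J * Nat.card (SelmerStructure.selmerGroup (ρ := E.torsionGaloisModule ((p ^ J : ℕ) : ℤ))
            (KummerPT.kummerStrict E (p ^ J) {(Sum.inr v : Place ℚ)}))) →
      ∃ J₂ : ℕ, ∀ J : ℕ, J₂ ≤ J →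
      ∀ (L : AddSubgroup (galoisCohomology ((E.torsionGaloisModule ((p ^ J : ℕ) : ℤ)).restrictField (v.adicCompletion ℚ)) 1)),
        L ⊓ E.kummerLocalConditionAt ((p ^ J : ℕ) : ℤ) (v.adicCompletion ℚ) = ⊥ →
        L ⊔ E.kummerLocalConditionAt ((p ^ J : ℕ) : ℤ) (v.adicCompletion ℚ) = ⊤ →
      ∀ (𝓛 : SelmerStructure (E.torsionGaloisModule ((p ^ J : ℕ) : ℤ))),
        (∀ w : InfinitePlace ℚ, 𝓛 (Sum.inl w) = E.kummerLocalConditionAt ((p ^ J : ℕ) : ℤ) w.Completion) →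
        𝓛 (Sum.inr v) = L →
        (∀ v' : HeightOneSpectrum (𝓞 ℚ), v' ≠ v → 𝓛 (Sum.inr v') = E.kummerLocalConditionAt ((p ^ J : ℕ) : ℤ) (v'.adicCompletion ℚ)) →
      ∀ (lam : (E.baseChange ℚ_[p]).toAffine.Point →+ ℤ_[p]), (∀ X, lam X = 0 ↔ IsOfFinAddOrder X) → Function.Surjective lam →
      ∀ (P₁ : E.toAffine.Point), (∀ P : E.toAffine.Point, ∃ (a : ℤ) (t : E.toAffine.Point), IsOfFinAddOrder t ∧ P = a • P₁ + t) →
        Nat.card 𝓛.selmerGroup =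
          Nat.card ↥(E.selmerGroupPInfty p ⊓ selmerLocalKerPrimaryTorsion E ℚ_[p] p) *
            p ^ (lam (Affine.Point.baseChange (W' := E) ℚ ℚ_[p] P₁)).valuation := by
  intro E _ p _ v hv h0v h0p h0 hr hsha hP1
  haveI := hsha
  have hp : p.Prime := Fact.out
  -- the strict `p^∞`-Selmer group `S⁰`; it is `p`-primary
  set S0 : AddSubgroup (galH1Primary E p) := E.selmerGroupPInfty p ⊓ selmerLocalKerPrimaryTorsion E ℚ_[p] p with hS0_def
  have hprim : ∀ a : ↥S0, ∃ n : ℕ, p ^ n • a = 0 := fun a ↦ by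
    obtain ⟨n, hn⟩ := Literature.NumberTheory.EllipticCurves.exists_pow_nsmul_eq_zero_galH1Primary E p (a : galH1Primary E p)
    exact ⟨n, Subtype.ext (by rw [AddSubmonoidClass.coe_nsmul, hn, ZeroMemClass.coe_zero])⟩
  -- its stabilisation level `J₀` if it is finite (it is, once `λ`, `P₁` are in hand: HT-C2)
  have hJ₀ex : ∃ J₀ : ℕ, Finite ↥S0 → ∀ J : ℕ, J₀ ≤ J → Nat.card ((↥S0)[((p ^ J : ℕ) : ℤ)]) = Nat.card ↥S0 := by
    by_cases hfin : Finite ↥S0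
    · obtain ⟨J₀, hJ₀⟩ := exists_forall_natCard_torsionBy_pow_eq (A := ↥S0) p hprim
      exact ⟨J₀, fun _ ↦ hJ₀⟩
    · exact ⟨0, fun h ↦ absurd h hfin⟩
  obtain ⟨J₀, hJ₀⟩ := hJ₀ex
  refine ⟨J₀ + 2 * Nat.card ↥S0 + 1, fun J hJ L hbot htop 𝓛 h𝓛inf h𝓛v h𝓛off lam hlam hsurj P₁ hgen ↦ ?_⟩
  /- (1) COUNTS. HT-C2: `#S⁰ = #Ш[p^∞] · p^e = p^s`, so `S⁰` is finite, `e ≤ s < #S⁰`, `e + s ≤ J`. -/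
  set e := (lam (Affine.Point.baseChange (W' := E) ℚ ℚ_[p] P₁)).valuation with he_def
  have hS0card : Nat.card ↥S0 = Nat.card (AddCommGroup.primaryComponent E.sha p) * p ^ e :=
    FlatBlindTwistSide.HTC2_natCard_strictSelmer_eq E p hr lam hlam hsurj P₁ hgen
  obtain ⟨n, hn⟩ := Literature.NumberTheory.EllipticCurves.exists_card_addPrimaryComponent_eq_pow (A := E.sha) p
  have hS0pow : Nat.card ↥S0 = p ^ (n + e) := by rw [hS0card, hn, pow_add]
  haveI hS0fin : Finite ↥S0 := Nat.finite_of_card_ne_zero (by rw [hS0pow]; exact pow_ne_zero _ hp.ne_zero)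
  set s := n + e with hs_def
  have hs_lt : s < Nat.card ↥S0 := by rw [hS0pow]; exact Nat.lt_pow_self hp.one_lt
  have heJ : e + s ≤ J := by omega
  have heJ' : e < J := by omega
  have h1J : 1 ≤ J := by omega
  have hJ₀J : J₀ ≤ J := by omega
  have hn0 : ((p ^ J : ℕ) : ℤ) ≠ 0 := by exact_mod_cast pow_ne_zero J hp.ne_zero
  -- the relaxed / strict Selmer groups `R ⊇ SJ` of `E[p^J]`
  set R := SelmerStructure.selmerGroup (ρ := E.torsionGaloisModule ((p ^ J : ℕ) : ℤ))
    (KummerPT.kummerRelaxed E (p ^ J) {(Sum.inr v : Place ℚ)}) with hR_def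
  -- `#SJ = #S⁰[p^J] = #S⁰ = p^s` (HT-C4(a) + stabilisation) and `#R = p^J · p^s` (P1)
  have hSJcard : Nat.card (SelmerStructure.selmerGroup (ρ := E.torsionGaloisModule ((p ^ J : ℕ) : ℤ))
      (KummerPT.kummerStrict E (p ^ J) {(Sum.inr v : Place ℚ)})) = p ^ s := by
    rw [FlatBlindLevelPassage.HTC4_natCard_selmerGroup_kummerStrict_eq E p v hv h0v J, hJ₀ hS0fin J hJ₀J, hS0pow]
  have hRcard : Nat.card ↥R = p ^ J * p ^ s := by rw [hR_def, hP1 J h1J, hSJcard]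
  have hRtors : ∀ x : ↥R, p ^ J • x = 0 := fun x ↦ by
    apply Subtype.ext
    rw [AddSubmonoidClass.coe_nsmul, ZeroMemClass.coe_zero]
    exact galoisCohomology.nsmul_eq_zero_of_forall (E.torsionGaloisModule ((p ^ J : ℕ) : ℤ))
      (fun T : geomTorsion E ((p ^ J : ℕ) : ℤ) ↦ AddSubgroup.torsionBy.nsmul T) _
  /- (2) THE STRUCTURES AGREE OFF `v`: `H¹_𝓛 = {c ∈ R | loc_v c ∈ L}` (localisation read at `ℚ_v`). -/
  set locv : galoisCohomology (E.torsionGaloisModule ((p ^ J : ℕ) : ℤ)) 1 →+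
      galoisCohomology ((E.torsionGaloisModule ((p ^ J : ℕ) : ℤ)).restrictField (v.adicCompletion ℚ)) 1 :=
    galoisCohomology.localization (E.torsionGaloisModule ((p ^ J : ℕ) : ℤ)) (Sum.inr v : Place ℚ) 1 with hlocv_def
  have hrel : KummerPT.kummerRelaxed E (p ^ J) {(Sum.inr v : Place ℚ)} (Sum.inr v) = ⊤ :=
    KummerPT.kummerRelaxed_of_mem E (p ^ J) _ (Finset.mem_singleton_self _)
  have hoff : ∀ w : Place ℚ, w ≠ Sum.inr v → 𝓛 w = KummerPT.kummerRelaxed E (p ^ J) {(Sum.inr v : Place ℚ)} w := by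
    intro w hw
    rw [KummerPT.kummerRelaxed_of_not_mem E (p ^ J) _ (by rwa [Finset.mem_singleton]),
      WeierstrassCurve.kummerSelmerStructure_apply]
    rcases w with w | v'
    · exact h𝓛inf w
    · exact h𝓛off v' (fun h ↦ hw (by rw [h]))
  have hle : 𝓛.selmerGroup ≤ R := SelmerStructure.selmerGroup_le_of_eq_top_of_eq_off hrel hoff
  have hmem𝓛 : ∀ c, c ∈ 𝓛.selmerGroup ↔ c ∈ R ∧ locv c ∈ L := fun c ↦ by
    rw [SelmerStructure.mem_selmerGroup_iff_of_eq_top_of_eq_off hrel hoff c]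
    refine and_congr_right fun _ ↦ ?_
    constructor
    · intro h; rw [h𝓛v] at h; exact h
    · intro h; rw [h𝓛v]; exact h
  /- (3) THE GLOBAL KUMMER CLASS `δ = κ(P₁) ∈ R`, of order `p^J` (read in `H¹(ℚ, E[p^J])`). -/
  have hdiv : ∀ P : geomPoints E, ∃ Q : geomPoints E, ((p ^ J : ℕ) : ℤ) • Q = P :=
    fun P ↦ E.zsmul_geomPoints_surjective_holds hn0 P
  set κ := kummerMapTorsion E ((p ^ J : ℕ) : ℤ) hdiv with hκ_def
  have hKR : (E.kummerSelmerStructure ((p ^ J : ℕ) : ℤ)).selmerGroup ≤ R := fun c hc ↦ by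
    rw [SelmerStructure.mem_selmerGroup_iff] at hc
    rw [hR_def, SelmerStructure.mem_selmerGroup_iff]
    intro w
    by_cases hw : w ∈ ({(Sum.inr v : Place ℚ)} : Finset (Place ℚ))
    · rw [KummerPT.kummerRelaxed_of_mem E (p ^ J) _ hw]; exact AddSubgroup.mem_top _
    · rw [KummerPT.kummerRelaxed_of_not_mem E (p ^ J) _ hw]; exact hc w
  have hκR : κ P₁ ∈ R := hKR (kummerMapTorsion_mem_selmerGroup_kummerSelmerStructure E hdiv P₁)
  set δ : ↥R := ⟨κ P₁, hκR⟩ with hδ_def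
  -- the generator hypothesis in the classical-`DecidableEq` currency of the generic (number-field) Kummer lemmas
  have hδord : addOrderOf δ = p ^ J :=
    addOrderOf_mk_kummerMapTorsion_generator E hr P₁ (fun P ↦ by
      obtain ⟨a, t, ht, h⟩ := hgen P; exact ⟨a, t, by convert ht, by convert h⟩) J hdiv R hκR
  /- (4) THE KUMMER LINE AT `v`: `C = H¹(ℚ_v, E[p^J]) / L` is cyclic of order `p^J` on `u = κ_v(Q₁) mod L`. -/
  obtain ⟨eqv, Q₁, heqv, hQ₁, hordQ₁, hgenK, hcoord⟩ := exists_kummerLine_generator E hv h0v lam hlam hsurj J hn0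
  set Kv := E.kummerLocalConditionAt ((p ^ J : ℕ) : ℤ) (v.adicCompletion ℚ) with hKv_def
  set κv := E.localKummerMap (v.adicCompletion ℚ) hn0 with hκv_def
  have hg₁K : κv Q₁ ∈ Kv := E.localKummerMap_mem (v.adicCompletion ℚ) hn0 Q₁
  set π := QuotientAddGroup.mk' L with hπ_def
  set u := π (κv Q₁) with hu_def
  have hu : addOrderOf u = p ^ J := by
    refine Eq.trans ?_ hordQ₁
    refine addOrderOf_eq_addOrderOf_iff.mpr fun k ↦ ⟨fun hk ↦ ?_, fun hk ↦ by rw [hu_def, ← map_nsmul, hk, map_zero]⟩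
    rw [hu_def, ← map_nsmul, hπ_def, QuotientAddGroup.mk'_apply, QuotientAddGroup.eq_zero_iff] at hk
    have hK : k • κv Q₁ ∈ Kv := AddSubgroup.nsmul_mem _ hg₁K k
    have hLK : k • κv Q₁ ∈ L ⊓ Kv := ⟨hk, hK⟩
    rw [hbot] at hLK
    exact (AddSubgroup.mem_bot).mp hLK
  have hC : ∀ c, c ∈ AddSubgroup.zmultiples u := by
    intro c
    obtain ⟨y, rfl⟩ := QuotientAddGroup.mk'_surjective L c
    have hy : y ∈ L ⊔ Kv := by rw [htop]; exact AddSubgroup.mem_top y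
    obtain ⟨l, hl, k, hk, rfl⟩ := AddSubgroup.mem_sup.mp hy
    obtain ⟨a, ha⟩ := AddSubgroup.mem_zmultiples_iff.mp (hgenK k hk)
    refine AddSubgroup.mem_zmultiples_iff.mpr ⟨a, ?_⟩
    rw [map_add, hu_def, hπ_def, QuotientAddGroup.mk'_apply, QuotientAddGroup.mk'_apply, QuotientAddGroup.mk'_apply,
      (QuotientAddGroup.eq_zero_iff l).mpr hl, zero_add, ← ha, QuotientAddGroup.mk_zsmul]
  /- (5) `Ψ = (mod L) ∘ loc_v` on `R`; `ker Ψ = H¹_𝓛`. -/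
  set Ψ : ↥R →+ _ := π.comp (locv.comp R.subtype) with hΨ_def
  have hker : ∀ x : ↥R, x ∈ Ψ.ker ↔ (x : galoisCohomology (E.torsionGaloisModule ((p ^ J : ℕ) : ℤ)) 1) ∈ 𝓛.selmerGroup :=
    fun x ↦ by
    rw [AddMonoidHom.mem_ker, hmem𝓛, hΨ_def, AddMonoidHom.comp_apply, AddMonoidHom.comp_apply, AddSubgroup.coe_subtype,
      hπ_def, QuotientAddGroup.mk'_apply, QuotientAddGroup.eq_zero_iff]
    exact ⟨fun h ↦ ⟨x.2, h⟩, fun h ↦ h.2⟩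
  have hkercard : Nat.card Ψ.ker = Nat.card 𝓛.selmerGroup := by
    have hK : Ψ.ker = (𝓛.selmerGroup).addSubgroupOf R := by
      ext x
      rw [hker, AddSubgroup.mem_addSubgroupOf]
    rw [hK]
    exact Nat.card_congr (AddSubgroup.addSubgroupOfEquivOfLe hle).toEquiv
  /- (6) `Ψ δ = m • u`, `m ≡ λ(P₁ ⊗ ℚ_p) (mod p^J)`, `m = p^e m₁ + p^J k`, `p ∤ m₁`. -/
  have hP₁ : ¬ IsOfFinAddOrder P₁ := by
    have h := not_isOfFinAddOrder_of_generator E hr P₁ (fun P ↦ by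
      obtain ⟨a, t, ht, h⟩ := hgen P; exact ⟨a, t, by convert ht, by convert h⟩)
    intro hfin
    exact h (by convert hfin)
  have hx0 : lam (Affine.Point.baseChange (W' := E) ℚ ℚ_[p] P₁) ≠ 0 := by
    intro h0'
    apply hP₁
    obtain ⟨k, hk, hkP⟩ := (isOfFinAddOrder_iff_nsmul_eq_zero).mp ((hlam _).mp h0')
    refine (isOfFinAddOrder_iff_nsmul_eq_zero).mpr ⟨k, hk, ?_⟩
    apply WeierstrassCurve.Affine.Point.map_injective (W' := E.toAffine) (f := Algebra.ofId ℚ ℚ_[p])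
    have e1 : Affine.Point.map (W' := E.toAffine) (Algebra.ofId ℚ ℚ_[p]) (k • P₁) =
        k • Affine.Point.baseChange (W' := E) ℚ ℚ_[p] P₁ := map_nsmul _ _ _
    rw [e1, hkP]
    exact (map_zero _).symm
  have hloc : locv (κ P₁) = κv (Affine.Point.baseChange (W' := E) ℚ (v.adicCompletion ℚ) P₁) :=
    localization_inr_kummerMapTorsion E hn0 hdiv v P₁
  obtain ⟨m, hm, hmcong⟩ := hcoord (Affine.Point.baseChange (W' := E) ℚ (v.adicCompletion ℚ) P₁)
  rw [heqv P₁] at hmcong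
  obtain ⟨m₁, k, hcop, hmk⟩ := exists_coprime_eq_pow_valuation_mul_add hx0 heJ' hmcong
  have hpJg : (p ^ J) • κv Q₁ = 0 := by
    have h := addOrderOf_nsmul_eq_zero (κv Q₁)
    rwa [hordQ₁] at h
  have hmg : m • κv Q₁ = (p ^ e * m₁) • κv Q₁ := by
    have h1 : ((p : ℤ) ^ J * k) • κv Q₁ = 0 := by
      rw [mul_comm, mul_zsmul, show ((p : ℤ) ^ J) = ((p ^ J : ℕ) : ℤ) by push_cast; rfl, natCast_zsmul, hpJg, zsmul_zero]
    rw [hmk, add_zsmul, h1, add_zero, show ((p : ℤ) ^ e * (m₁ : ℤ)) = ((p ^ e * m₁ : ℕ) : ℤ) by push_cast; rfl,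
      natCast_zsmul]
  have hΨδ : Ψ δ = (p ^ e * m₁) • u := by
    change π (locv (κ P₁)) = _
    rw [hloc, hm, hmg, map_nsmul]
  /- (7) THE POSITION CORE. -/
  have hcore := natCard_ker_eq_of_cyclic_position_coprime hp heJ hRtors hRcard δ hδord u hu hC Ψ hcop hΨδ
  rw [← hkercard, hcore, hS0pow]

end OddBlindLocal

end Summit.BirchSwinnertonDyer.BirchSwinnertonDyer.Theorems

end
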